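import Literature.NumberTheory.Rogawski1990.ArchEndoscopicTorusTransferIdentityPre  -- ★ (β₀) p841820 (F0P3a-p02 (g11)): ★ (3H)-univ ∘ ★ (E1) at an abstract torus point; brings ★ (E1), ★ (3H) + adapter, ★ (3R-H)∕(3R-G′)
import Literature.NumberTheory.Rogawski1990.ArchDeltaClassSumCongruence           -- ★ 3Z FILE (α): `finsum_delta_mul_integral_comp_conj_eq_comap`, `compactSpace_centralizer_of_isArchNormPair_of_archCongr`
import Literature.NumberTheory.Automorphic.ArchEndoscopicDiagonalCongruence       -- ★ (R3-a) p841011: `formCongr_quasiSplitFrameTwo_diagonal`, the weights `β₂ = (½, −½)`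
import HarnessLib

/-!
# Lemma 14.5.2 (c) at `∞`, the TORUS IDENTITY: along B-p12's lifted curve the symmetrised product orbital integral of `aH` on the diagonalised 2-block equals, up to ONE positive constant,
# the `Δ′`-weighted Haar class sum of `a′` read on the rational diagonal frame of `G′_∞` (Rogawski 1990 §4.3 (4.3.1) p. 43, §14.3 p. 234, §14.5 p. 238)

Topic `NumberTheory/Rogawski1990`; namespace `Literature.NumberTheory.Rogawski1990`.  THEOREMS ONLY (no `def`, no instance, no notation, no axiom, no named fact, no `sorry`).
Cell `pub/hodgecm-mathlib`, ENGINE T1 (crux H413 = `stmt-HodgeConjecture-24833`); ROAD-Sd residual R3 «(S-c) central vanishing» (`stub_ScCore` of `Cruxes/H413/Lines/F0_P3a_SdArch.lean`),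
STEP 3 of `CENSUS-R3-STEP3-Integration` (pen of record F0P3a-p03; LEAD WORDS T8-76 (C), T8-92 (1)): FILE (β) of the 3Z assembly = ★ (β₀) ∘ (3R-G′) ∘ (α) composed along B-p12's curve; author F0P3a-p03 (g11), 2026-09-01.

THE FRAME.  The letter's frame `(L, H′, T, ν′, νH, mH, m′, tH, t′, t)` with the compatibilities (W_H) (W′) (C) (C′G) (C_H) of a thirteen-conjunct system (binders of ★ (E1)
`finsum_integral_comp_conj_eq_finsum_delta_mul_integral_comp_conj_of_isArchDeltaTransfer` VERBATIM) and a `Δ′`-pair `(aH, a′)` (`IsArchDeltaTransfer`); a rational diagonal frame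
`Φ : U(diagonal α)(L ⊗ ℝ) ≃ₜ* U(H′)(L ⊗ ℝ)`, `g ↦ T₃ g T₃⁻¹` (★ `exists_formCongr_eq_diagonal`, ★ FILE 1 `coe_archCongrOfEq_apply`); on the `H`-side the endoscopic congruence
`Ψ = Φ_{Q₂} : U(Φ₂)(L ⊗ ℝ) ≃ₜ* U(diag(½,−½))(L ⊗ ℝ)` of ★ (R3-a) and per-place Haar measures `ν_w` on `U(diag(½,−½))(L_w)`; B-p12's lifted curve `(γH, γG)` (★ `ArchSingularCurveNormPair`:
2-block angles `z₀_w,0 e^{ic_wψ}, z₀_w,2 e^{−ic_wψ}` in the Cayley frame, `U(Φ₁)`-angle `z₀_w,1`).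

WHAT IS PROVED.  **`sum_integral_pi_eq_inv_mul_finsum_delta_comap_archSingularCurve`**: there is ONE `κ > 0` (★ (3H): depends on `νH`, `ν_w`, `Ψ` only) such that at every parameter `ψ` where the
three angles are pairwise distinct at every place,
  `Σ_{ε : W → Bool} ∫ aH(Ψ⁻¹ e⁻¹ o, γH(ψ).2) d(⊗_w M(S, u(ψ), ε)_w)(o) = κ⁻¹ · Σᶠ_{c″ : ConjClasses U(diagonal α)_∞} (Δ′ ∘ (id × Φ))(γH(ψ), out c″) · ∫ (a′ ∘ Φ)(g·out c″·g⁻¹) d(Φ⁻¹_*ν′)(g)`,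
`u(ψ)_w = (z₀_w,0 e^{ic_wψ}, z₀_w,2 e^{−ic_wψ})`, the measure family `M(S, u, ε)` written EXACTLY as ★ (E2) `ArchEndoscopicCentralDescent` writes it (`S` a variable with `hS : S = univ`).
Chain: ★ (β₀) `exists_sum_integral_pi_eq_inv_mul_finsum_delta` (F0P3a-p02 (g11): ★ (3H) `…_univ` ∘ ★ (E1), the `hZH` binder discharged inside by ★ (3R-H)) at `(u(ψ), δ = γH(ψ).2)`
(the point is `γH(ψ)` by the ★ adapter `archCongrOfEq_quasiSplitFrameTwo_symm_archDiagTorus`) — its binders `hreg` ★ `isArchGRegular_archSingularCurve` and `hZ′` ★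
`compactSpace_centralizer_of_isArchNormPair_archSingularCurve` carried to `U(H′)` by ★ (α) `compactSpace_centralizer_of_isArchNormPair_of_archCongr` · then ★ (α)
`finsum_delta_mul_integral_comp_conj_eq_comap` on the right.  The 3Z closer feeds the right side to ★ (3G♭)
`exists_flat_gSide_centralCurve_of_archSmooth` and the left side to ★ (E2) §2 `sum_integral_pi_erase_eq_zero_of_eventuallyEq`.
HONEST LABEL: HC_CM is proved only modulo the 7 printed citations until rung 0 closes; this file is composition bookkeeping and pays nothing by itself.

## References
* [Rogawski1990] J. D. Rogawski, *Automorphic Representations of Unitary Groups in Three Variables*, Ann. of Math. Stud. 123 (1990), §4.3 (4.3.1) p. 43; §14.3 pp. 233–234; §14.4 p. 237;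
  §14.5 Lemma 14.5.2 (c) p. 238; §3.7 Prop. 3.7.1 pp. 29–30.
* [BorelJacquet1979] A. Borel, H. Jacquet, *Automorphic forms and automorphic representations*, PSPM 33.1 (1979), §4.1.
-/

set_option autoImplicit false

noncomputable section

open MeasureTheory Measure NumberField NumberField.InfinitePlace NumberField.mixedEmbedding Topology
open scoped Matrix MatrixGroups ComplexOrder

namespace Literature.NumberTheory.Rogawski1990

open Literature.MeasureTheory.Group Literature.NumberTheory.Automorphic Literature.NumberTheory.Automorphic.UnitaryGroup

section Torus

variable (L : Type) [Field L] [NumberField L] [IsCMField L] (H' : Matrix (Fin 3) (Fin 3) L)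
  [MeasurableSpace (UnitaryGroup.arch (↥(maximalRealSubfield L)) L (IsCMField.complexConj L) 3 H')]
  [BorelSpace (UnitaryGroup.arch (↥(maximalRealSubfield L)) L (IsCMField.complexConj L) 3 H')]
  [MeasurableSpace (UnitaryGroup.arch (↥(maximalRealSubfield L)) L (IsCMField.complexConj L) 3
    (Matrix.of fun i j : Fin 3 => if i.val + j.val + 1 = 3 then (1 : L) else 0))]
  [BorelSpace (UnitaryGroup.arch (↥(maximalRealSubfield L)) L (IsCMField.complexConj L) 3
    (Matrix.of fun i j : Fin 3 => if i.val + j.val + 1 = 3 then (1 : L) else 0))]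
  [MeasurableSpace (UnitaryGroup.arch (↥(maximalRealSubfield L)) L (IsCMField.complexConj L) 2
          (Matrix.of fun i j : Fin 2 => if i.val + j.val + 1 = 2 then (1 : L) else 0) ×
        UnitaryGroup.arch (↥(maximalRealSubfield L)) L (IsCMField.complexConj L) 1
          (Matrix.of fun i j : Fin 1 => if i.val + j.val + 1 = 1 then (1 : L) else 0))]
  [BorelSpace (UnitaryGroup.arch (↥(maximalRealSubfield L)) L (IsCMField.complexConj L) 2
          (Matrix.of fun i j : Fin 2 => if i.val + j.val + 1 = 2 then (1 : L) else 0) ×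
        UnitaryGroup.arch (↥(maximalRealSubfield L)) L (IsCMField.complexConj L) 1
          (Matrix.of fun i j : Fin 1 => if i.val + j.val + 1 = 1 then (1 : L) else 0))]
  (tH : ∀ γH : UnitaryGroup.arch (↥(maximalRealSubfield L)) L (IsCMField.complexConj L) 2
          (Matrix.of fun i j : Fin 2 => if i.val + j.val + 1 = 2 then (1 : L) else 0) ×
        UnitaryGroup.arch (↥(maximalRealSubfield L)) L (IsCMField.complexConj L) 1
          (Matrix.of fun i j : Fin 1 => if i.val + j.val + 1 = 1 then (1 : L) else 0),
    Measure (Subgroup.centralizer ({γH} : Set (UnitaryGroup.arch (↥(maximalRealSubfield L)) L (IsCMField.complexConj L) 2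
          (Matrix.of fun i j : Fin 2 => if i.val + j.val + 1 = 2 then (1 : L) else 0) ×
        UnitaryGroup.arch (↥(maximalRealSubfield L)) L (IsCMField.complexConj L) 1
          (Matrix.of fun i j : Fin 1 => if i.val + j.val + 1 = 1 then (1 : L) else 0)))))
  (t' : ∀ γ' : UnitaryGroup.arch (↥(maximalRealSubfield L)) L (IsCMField.complexConj L) 3 H',
    Measure (Subgroup.centralizer ({γ'} : Set (UnitaryGroup.arch (↥(maximalRealSubfield L)) L (IsCMField.complexConj L) 3 H'))))
  (t : ∀ γ : UnitaryGroup.arch (↥(maximalRealSubfield L)) L (IsCMField.complexConj L) 3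
        (Matrix.of fun i j : Fin 3 => if i.val + j.val + 1 = 3 then (1 : L) else 0),
    Measure (Subgroup.centralizer ({γ} : Set (UnitaryGroup.arch (↥(maximalRealSubfield L)) L (IsCMField.complexConj L) 3
        (Matrix.of fun i j : Fin 3 => if i.val + j.val + 1 = 3 then (1 : L) else 0)))))
  (hd' : H'.det ≠ 0) (hd₃ : (Matrix.of fun i j : Fin 3 => if i.val + j.val + 1 = 3 then (1 : L) else 0).det ≠ 0)
  -- (C)
  (hC : ∀ (γ₁ γ₂ : UnitaryGroup.arch (↥(maximalRealSubfield L)) L (IsCMField.complexConj L) 3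
        (Matrix.of fun i j : Fin 3 => if i.val + j.val + 1 = 3 then (1 : L) else 0))
      (h₁ : IsRegularElt (γ₁.val : GL (Fin 3) (mixedEmbedding.mixedSpace L)))
      (hc : Corresponds (UnitaryGroup.conjMixed (↥(maximalRealSubfield L)) L (IsCMField.complexConj L))
        (UnitaryGroup.archFormOf L 3 (Matrix.of fun i j : Fin 3 => if i.val + j.val + 1 = 3 then (1 : L) else 0))
        (UnitaryGroup.archFormOf L 3 (Matrix.of fun i j : Fin 3 => if i.val + j.val + 1 = 3 then (1 : L) else 0)) γ₁ γ₂),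
      Measure.map ⇑(UnitaryGroup.archStableCentralizerEquiv L hd₃ hd₃ hc h₁) (t γ₁) = t γ₂)
  -- (C′G)
  (hC'G : ∀ (γ' : UnitaryGroup.arch (↥(maximalRealSubfield L)) L (IsCMField.complexConj L) 3 H')
      (γ : UnitaryGroup.arch (↥(maximalRealSubfield L)) L (IsCMField.complexConj L) 3
        (Matrix.of fun i j : Fin 3 => if i.val + j.val + 1 = 3 then (1 : L) else 0))
      (h' : IsRegularElt (γ'.val : GL (Fin 3) (mixedEmbedding.mixedSpace L)))
      (hc : Corresponds (UnitaryGroup.conjMixed (↥(maximalRealSubfield L)) L (IsCMField.complexConj L))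
        (UnitaryGroup.archFormOf L 3 H')
        (UnitaryGroup.archFormOf L 3 (Matrix.of fun i j : Fin 3 => if i.val + j.val + 1 = 3 then (1 : L) else 0)) γ' γ),
      Measure.map ⇑(UnitaryGroup.archStableCentralizerEquiv L hd' hd₃ hc h') (t' γ') = t γ)
  -- (C_H)
  (hCH : ∀ γH : UnitaryGroup.arch (↥(maximalRealSubfield L)) L (IsCMField.complexConj L) 2
          (Matrix.of fun i j : Fin 2 => if i.val + j.val + 1 = 2 then (1 : L) else 0) ×
        UnitaryGroup.arch (↥(maximalRealSubfield L)) L (IsCMField.complexConj L) 1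
          (Matrix.of fun i j : Fin 1 => if i.val + j.val + 1 = 1 then (1 : L) else 0),
      IsArchGRegular L γH → Measure.map ⇑(endoEmbArchCentralizer L γH) (tH γH) = t (endoEmbArch L γH))
  [∀ γ' : UnitaryGroup.arch (↥(maximalRealSubfield L)) L (IsCMField.complexConj L) 3 H',
    MeasurableSpace (UnitaryGroup.arch (↥(maximalRealSubfield L)) L (IsCMField.complexConj L) 3 H' ⧸
      Subgroup.centralizer ({γ'} : Set (UnitaryGroup.arch (↥(maximalRealSubfield L)) L (IsCMField.complexConj L) 3 H')))]
  [∀ γ' : UnitaryGroup.arch (↥(maximalRealSubfield L)) L (IsCMField.complexConj L) 3 H',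
    BorelSpace (UnitaryGroup.arch (↥(maximalRealSubfield L)) L (IsCMField.complexConj L) 3 H' ⧸
      Subgroup.centralizer ({γ'} : Set (UnitaryGroup.arch (↥(maximalRealSubfield L)) L (IsCMField.complexConj L) 3 H')))]
  [∀ a : (UnitaryGroup.arch (↥(maximalRealSubfield L)) L (IsCMField.complexConj L) 2
          (Matrix.of fun i j : Fin 2 => if i.val + j.val + 1 = 2 then (1 : L) else 0) ×
        UnitaryGroup.arch (↥(maximalRealSubfield L)) L (IsCMField.complexConj L) 1
          (Matrix.of fun i j : Fin 1 => if i.val + j.val + 1 = 1 then (1 : L) else 0)),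
    MeasurableSpace ((UnitaryGroup.arch (↥(maximalRealSubfield L)) L (IsCMField.complexConj L) 2
          (Matrix.of fun i j : Fin 2 => if i.val + j.val + 1 = 2 then (1 : L) else 0) ×
        UnitaryGroup.arch (↥(maximalRealSubfield L)) L (IsCMField.complexConj L) 1
          (Matrix.of fun i j : Fin 1 => if i.val + j.val + 1 = 1 then (1 : L) else 0)) ⧸
      Subgroup.centralizer ({a} : Set (UnitaryGroup.arch (↥(maximalRealSubfield L)) L (IsCMField.complexConj L) 2
          (Matrix.of fun i j : Fin 2 => if i.val + j.val + 1 = 2 then (1 : L) else 0) ×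
        UnitaryGroup.arch (↥(maximalRealSubfield L)) L (IsCMField.complexConj L) 1
          (Matrix.of fun i j : Fin 1 => if i.val + j.val + 1 = 1 then (1 : L) else 0))))]
  [∀ a : (UnitaryGroup.arch (↥(maximalRealSubfield L)) L (IsCMField.complexConj L) 2
          (Matrix.of fun i j : Fin 2 => if i.val + j.val + 1 = 2 then (1 : L) else 0) ×
        UnitaryGroup.arch (↥(maximalRealSubfield L)) L (IsCMField.complexConj L) 1
          (Matrix.of fun i j : Fin 1 => if i.val + j.val + 1 = 1 then (1 : L) else 0)),
    BorelSpace ((UnitaryGroup.arch (↥(maximalRealSubfield L)) L (IsCMField.complexConj L) 2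
          (Matrix.of fun i j : Fin 2 => if i.val + j.val + 1 = 2 then (1 : L) else 0) ×
        UnitaryGroup.arch (↥(maximalRealSubfield L)) L (IsCMField.complexConj L) 1
          (Matrix.of fun i j : Fin 1 => if i.val + j.val + 1 = 1 then (1 : L) else 0)) ⧸
      Subgroup.centralizer ({a} : Set (UnitaryGroup.arch (↥(maximalRealSubfield L)) L (IsCMField.complexConj L) 2
          (Matrix.of fun i j : Fin 2 => if i.val + j.val + 1 = 2 then (1 : L) else 0) ×
        UnitaryGroup.arch (↥(maximalRealSubfield L)) L (IsCMField.complexConj L) 1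
          (Matrix.of fun i j : Fin 1 => if i.val + j.val + 1 = 1 then (1 : L) else 0))))]
  -- the rational diagonal `G′`-frame
  (α : Fin 3 → L)
  [MeasurableSpace (UnitaryGroup.arch (↥(maximalRealSubfield L)) L (IsCMField.complexConj L) 3 (Matrix.diagonal α))]
  [BorelSpace (UnitaryGroup.arch (↥(maximalRealSubfield L)) L (IsCMField.complexConj L) 3 (Matrix.diagonal α))]
  (T₃ : GL (Fin 3) (mixedSpace L))
  (Φ : UnitaryGroup.arch (↥(maximalRealSubfield L)) L (IsCMField.complexConj L) 3 (Matrix.diagonal α) ≃ₜ* UnitaryGroup.arch (↥(maximalRealSubfield L)) L (IsCMField.complexConj L) 3 H')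
  (hΦ : ∀ g : UnitaryGroup.arch (↥(maximalRealSubfield L)) L (IsCMField.complexConj L) 3 (Matrix.diagonal α),
    ((Φ g : UnitaryGroup.arch (↥(maximalRealSubfield L)) L (IsCMField.complexConj L) 3 H') : GL (Fin 3) (mixedSpace L)) = T₃ * (g : GL (Fin 3) (mixedSpace L)) * T₃⁻¹)
  -- the 2-block Haar data on `U(diag(½,−½))(L_w)`
  [∀ w : {w : InfinitePlace L // IsComplex w}, MeasurableSpace (UnitaryGroup.archLocal L 2 (Matrix.diagonal ![(2 : L)⁻¹, -(2 : L)⁻¹]) w)]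
  [∀ w : {w : InfinitePlace L // IsComplex w}, BorelSpace (UnitaryGroup.archLocal L 2 (Matrix.diagonal ![(2 : L)⁻¹, -(2 : L)⁻¹]) w)]
  (νw : ∀ w : {w : InfinitePlace L // IsComplex w}, Measure (UnitaryGroup.archLocal L 2 (Matrix.diagonal ![(2 : L)⁻¹, -(2 : L)⁻¹]) w)) [∀ w, (νw w).IsHaarMeasure]
  -- B-p12's lifted curve (★ `ArchSingularCurveNormPair` frame VERBATIM)
  (z₀ : {w : InfinitePlace L // IsComplex w} → Fin 3 → Circle) (c : {w : InfinitePlace L // IsComplex w} → ℝ)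
  (γH : ℝ →
    ↥(UnitaryGroup.arch (↥(maximalRealSubfield L)) L (IsCMField.complexConj L) 2
        (Matrix.of fun i j : Fin 2 => if i.val + j.val + 1 = 2 then (1 : L) else 0)) ×
      ↥(UnitaryGroup.arch (↥(maximalRealSubfield L)) L (IsCMField.complexConj L) 1
        (Matrix.of fun i j : Fin 1 => if i.val + j.val + 1 = 1 then (1 : L) else 0)))
  (γG : ℝ → ↥(UnitaryGroup.arch (↥(maximalRealSubfield L)) L (IsCMField.complexConj L) 3 (Matrix.diagonal α)))
  (hγH : γH = fun ψ =>
    ((UnitaryGroup.archPiEquivCM 2 L (Matrix.of fun i j : Fin 2 => if i.val + j.val + 1 = 2 then (1 : L) else 0)).symm fun w =>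
        ⟨Matrix.GeneralLinearGroup.mkOfDetNeZero !![(1 : ℂ), 1; 1, -1] UnitaryGroup.det_cayleyTwo_ne_zero *
            UnitaryGroup.circleDiagonal 2 ![z₀ w 0 * Circle.exp (![(1 : ℝ), 0, -1] 0 * (c w * ψ)), z₀ w 2 * Circle.exp (![(1 : ℝ), 0, -1] 2 * (c w * ψ))] *
          (Matrix.GeneralLinearGroup.mkOfDetNeZero !![(1 : ℂ), 1; 1, -1] UnitaryGroup.det_cayleyTwo_ne_zero)⁻¹,
          UnitaryGroup.cayley_conj_circleDiagonal_mem_archLocal L w _⟩,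
      (UnitaryGroup.archPiEquivCM 1 L (Matrix.of fun i j : Fin 1 => if i.val + j.val + 1 = 1 then (1 : L) else 0)).symm fun w =>
        ⟨UnitaryGroup.circleDiagonal 1 ![z₀ w 1 * Circle.exp (![(1 : ℝ), 0, -1] 1 * (c w * ψ))],
          UnitaryGroup.circleDiagonal_mem_archLocal_antidiagOne L w _⟩))
  (hγG : γG = fun ψ => UnitaryGroup.archDiagTorus L 3 α fun w i => z₀ w i * Circle.exp (![(1 : ℝ), 0, -1] i * (c w * ψ)))

include hC hC'G hCH hΦ hγH hγG in
open scoped Classical in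
/-- **THE TORUS IDENTITY ALONG B-p12's CURVE** (★ (β₀) ∘ ★ (3R-G′) ∘ ★ (α) of STEP 3 composed).  In the frame above, with `aH`, `a′` measurable and `IsArchDeltaTransfer L H′ T mH m′ aH a′` ((vi)), there is ONE `κ > 0`
such that at every parameter `ψ` where the three angles `z₀_w,i e^{i s_i c_w ψ}` are pairwise distinct at EVERY place,
`Σ_{ε : W → Bool} ∫ aH(Ψ⁻¹ e⁻¹ o, γH(ψ).2) d(⊗_w M(S, u(ψ), ε)_w)(o) = κ⁻¹ · Σᶠ_{c″} (T.comap Φ _).Δ (γH ψ) (out c″) · ∫ (a′ ∘ Φ)(g·out c″·g⁻¹) d(Φ⁻¹_*ν′)(g)`, `u(ψ)_w = (z₀_w,0 e^{ic_wψ}, z₀_w,2 e^{−ic_wψ})`,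
`M(S, u, ε)` = ★ (E2)'s measure family (`S = univ`); the datum `U = u(ψ)` and the integrand `F` are free binders pinned by pointwise equations (`hU`, `hF`), so that the 3Z closer
instantiates them with ★ (E2)'s own tokens (`Function.update u w₀ …`, `o ↦ Θ₂ ↑↑(e⁻¹ o)`).  ★ (β₀) `exists_sum_integral_pi_eq_inv_mul_finsum_delta` (= ★ (3H)-univ ∘ ★ (E1), `hZH` inside) at the point `γH(ψ)` (★ adapter
`archCongrOfEq_quasiSplitFrameTwo_symm_archDiagTorus`), its binders `hreg` ∕ `hZ′` from ★ (3R-G′) and ★ (α) §3, then ★ (α) §2 on the right.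
[cite: Rogawski1990, §4.3 (4.3.1) p. 43; §14.3 p. 234; §14.4 p. 237; §14.5 Lemma 14.5.2 (c) p. 238] [cite: BorelJacquet1979, §4.1] -/
theorem sum_integral_pi_eq_inv_mul_finsum_delta_comap_archSingularCurve (T : ArchTransferFactor L H')
    (ν' : Measure (UnitaryGroup.arch (↥(maximalRealSubfield L)) L (IsCMField.complexConj L) 3 H'))
    (νH : Measure (UnitaryGroup.arch (↥(maximalRealSubfield L)) L (IsCMField.complexConj L) 2
            (Matrix.of fun i j : Fin 2 => if i.val + j.val + 1 = 2 then (1 : L) else 0) ×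
          UnitaryGroup.arch (↥(maximalRealSubfield L)) L (IsCMField.complexConj L) 1
            (Matrix.of fun i j : Fin 1 => if i.val + j.val + 1 = 1 then (1 : L) else 0)))
    [ν'.IsHaarMeasure] [ν'.IsMulRightInvariant] [νH.IsHaarMeasure] [νH.IsMulRightInvariant]
    (mH : OrbitalMeasureFamily (UnitaryGroup.arch (↥(maximalRealSubfield L)) L (IsCMField.complexConj L) 2
            (Matrix.of fun i j : Fin 2 => if i.val + j.val + 1 = 2 then (1 : L) else 0) ×
          UnitaryGroup.arch (↥(maximalRealSubfield L)) L (IsCMField.complexConj L) 1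
            (Matrix.of fun i j : Fin 1 => if i.val + j.val + 1 = 1 then (1 : L) else 0)))
    (m' : OrbitalMeasureFamily (UnitaryGroup.arch (↥(maximalRealSubfield L)) L (IsCMField.complexConj L) 3 H'))
    (hWH : mH.IsQuotientOf (IsArchGRegular L) νH tH)
    (hW' : m'.IsQuotientOf (fun γ => IsRegularElt (γ.val : GL (Fin 3) (mixedEmbedding.mixedSpace L))) ν' t')
    (aH : (UnitaryGroup.arch (↥(maximalRealSubfield L)) L (IsCMField.complexConj L) 2 (Matrix.of fun i j : Fin 2 => if i.val + j.val + 1 = 2 then (1 : L) else 0) ×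
          UnitaryGroup.arch (↥(maximalRealSubfield L)) L (IsCMField.complexConj L) 1 (Matrix.of fun i j : Fin 1 => if i.val + j.val + 1 = 1 then (1 : L) else 0)) → ℂ)
    (a' : UnitaryGroup.arch (↥(maximalRealSubfield L)) L (IsCMField.complexConj L) 3 H' → ℂ)
    (haH : Measurable aH) (ha' : Measurable a') (hδ : IsArchDeltaTransfer L H' T mH m' aH a')
    (hα : ∀ i, α i ≠ 0) (hherm : ∀ i, (IsCMField.complexConj L (α i) : L) = α i)
    (z : {w : InfinitePlace L // IsComplex w} → Circle) (S : Finset {w : InfinitePlace L // IsComplex w}) (hS : S = Finset.univ) :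
    ∃ κ : ℝ, 0 < κ ∧ ∀ (ψ : ℝ) (U : {w : InfinitePlace L // IsComplex w} → Fin 2 → Circle)
      (F : (∀ w : {w : InfinitePlace L // IsComplex w}, UnitaryGroup.archLocal L 2 (Matrix.diagonal ![(2 : L)⁻¹, -(2 : L)⁻¹]) w) → ℂ),
      (∀ w, U w = ![z₀ w 0 * Circle.exp (![(1 : ℝ), 0, -1] 0 * (c w * ψ)), z₀ w 2 * Circle.exp (![(1 : ℝ), 0, -1] 2 * (c w * ψ))]) →
      (∀ o, F o = aH ((unitaryGroupOfFormCongrOfEq (UnitaryGroup.conjMixed (↥(maximalRealSubfield L)) L (IsCMField.complexConj L))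
                (Matrix.GeneralLinearGroup.map (mixedEmbedding L) (Matrix.GeneralLinearGroup.mkOfDetNeZero !![(1 : L), 1; 1, -1] (UnitaryGroup.det_quasiSplitFrameTwo_ne_zero L)))
                (UnitaryGroup.archFormOf L 2 (Matrix.diagonal ![(2 : L)⁻¹, -(2 : L)⁻¹])) (UnitaryGroup.archFormOf L 2 (Matrix.of fun i j : Fin 2 => if i.val + j.val + 1 = 2 then (1 : L) else 0))
                (UnitaryGroup.formCongr_map_mixedEmbedding_archFormOf_eq L (UnitaryGroup.formCongr_quasiSplitFrameTwo_diagonal L))).symm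
                ((UnitaryGroup.archPiEquivCM 2 L (Matrix.diagonal ![(2 : L)⁻¹, -(2 : L)⁻¹])).symm o), (γH ψ).2)) →
      (∀ w : {w : InfinitePlace L // IsComplex w}, Function.Injective (fun i : Fin 3 => z₀ w i * Circle.exp (![(1 : ℝ), 0, -1] i * (c w * ψ)))) →
      ∑ ε : {w : InfinitePlace L // IsComplex w} → Bool,
          ∫ o, F o
            ∂(Measure.pi (fun w : {w : InfinitePlace L // IsComplex w} =>
                if w ∈ S then (νw w).map (fun g : UnitaryGroup.archLocal L 2 (Matrix.diagonal ![(2 : L)⁻¹, -(2 : L)⁻¹]) w =>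
                  g * ⟨UnitaryGroup.circleDiagonal 2 (if ε w then U w ∘ ⇑(Equiv.swap (0 : Fin 2) 1) else U w),
                    UnitaryGroup.circleDiagonal_mem_archLocal_diagonal L 2 ![(2 : L)⁻¹, -(2 : L)⁻¹] w _⟩ * g⁻¹)
                else Measure.dirac (⟨UnitaryGroup.circleDiagonal 2 ![z w, z w], UnitaryGroup.circleDiagonal_mem_archLocal_diagonal L 2 ![(2 : L)⁻¹, -(2 : L)⁻¹] w _⟩ :
                  UnitaryGroup.archLocal L 2 (Matrix.diagonal ![(2 : L)⁻¹, -(2 : L)⁻¹]) w))) =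
        ((κ⁻¹ : ℝ) : ℂ) * ∑ᶠ c'' : ConjClasses (UnitaryGroup.arch (↥(maximalRealSubfield L)) L (IsCMField.complexConj L) 3 (Matrix.diagonal α)),
          (T.comap Φ.toMulEquiv (isArchNormPair_of_archCongr L T₃ Φ hΦ) : ArchTransferFactor L (Matrix.diagonal α)).Δ (γH ψ) (Quotient.out c'') *
            ∫ g, (a' ∘ Φ) (g * Quotient.out c'' * g⁻¹) ∂(ν'.map Φ.symm) := by
  -- ★ (β₀) = ★ (3H)-univ ∘ ★ (E1) at an abstract torus point of the 2-block frame `β₂ = (½, −½)`, `Ψ = Φ_{Q₂}`: ONE `κ`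
  obtain ⟨κ, hκ, hβ₀⟩ := exists_sum_integral_pi_eq_inv_mul_finsum_delta L H' tH t' t hd' hd₃ hC hC'G hCH T ν' νH mH m' hWH hW'
    (![(2 : L)⁻¹, -(2 : L)⁻¹]) (quasiSplitWeightsTwo_ne_zero (L := L)) (fun i => cmConjRingHom_quasiSplitWeightsTwo L i) (re_embedding_quasiSplitWeightsTwo_mul_neg L) νw
    (Matrix.GeneralLinearGroup.map (mixedEmbedding L) (Matrix.GeneralLinearGroup.mkOfDetNeZero !![(1 : L), 1; 1, -1] (UnitaryGroup.det_quasiSplitFrameTwo_ne_zero L)))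
    (unitaryGroupOfFormCongrOfEq (UnitaryGroup.conjMixed (↥(maximalRealSubfield L)) L (IsCMField.complexConj L))
      (Matrix.GeneralLinearGroup.map (mixedEmbedding L) (Matrix.GeneralLinearGroup.mkOfDetNeZero !![(1 : L), 1; 1, -1] (UnitaryGroup.det_quasiSplitFrameTwo_ne_zero L)))
      (UnitaryGroup.archFormOf L 2 (Matrix.diagonal ![(2 : L)⁻¹, -(2 : L)⁻¹])) (UnitaryGroup.archFormOf L 2 (Matrix.of fun i j : Fin 2 => if i.val + j.val + 1 = 2 then (1 : L) else 0))
      (UnitaryGroup.formCongr_map_mixedEmbedding_archFormOf_eq L (UnitaryGroup.formCongr_quasiSplitFrameTwo_diagonal L)))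
    (fun x => UnitaryGroup.coe_archCongrOfEq_apply L (UnitaryGroup.formCongr_quasiSplitFrameTwo_diagonal L) x) z S hS
  refine ⟨κ, hκ, fun ψ U F hU hF hinj => ?_⟩
  -- the 2-block datum and the integrand, literally
  obtain rfl : U = fun w => ![z₀ w 0 * Circle.exp (![(1 : ℝ), 0, -1] 0 * (c w * ψ)), z₀ w 2 * Circle.exp (![(1 : ℝ), 0, -1] 2 * (c w * ψ))] := funext hU
  obtain rfl : F = fun o => aH ((unitaryGroupOfFormCongrOfEq (UnitaryGroup.conjMixed (↥(maximalRealSubfield L)) L (IsCMField.complexConj L))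
                (Matrix.GeneralLinearGroup.map (mixedEmbedding L) (Matrix.GeneralLinearGroup.mkOfDetNeZero !![(1 : L), 1; 1, -1] (UnitaryGroup.det_quasiSplitFrameTwo_ne_zero L)))
                (UnitaryGroup.archFormOf L 2 (Matrix.diagonal ![(2 : L)⁻¹, -(2 : L)⁻¹])) (UnitaryGroup.archFormOf L 2 (Matrix.of fun i j : Fin 2 => if i.val + j.val + 1 = 2 then (1 : L) else 0))
                (UnitaryGroup.formCongr_map_mixedEmbedding_archFormOf_eq L (UnitaryGroup.formCongr_quasiSplitFrameTwo_diagonal L))).symm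
                ((UnitaryGroup.archPiEquivCM 2 L (Matrix.diagonal ![(2 : L)⁻¹, -(2 : L)⁻¹])).symm o), (γH ψ).2) := funext hF
  beta_reduce
  -- the 2-block datum `u(ψ)` is regular at every place
  have hu : ∀ w : {w : InfinitePlace L // IsComplex w},
      (![z₀ w 0 * Circle.exp (![(1 : ℝ), 0, -1] 0 * (c w * ψ)), z₀ w 2 * Circle.exp (![(1 : ℝ), 0, -1] 2 * (c w * ψ))]) 0 ≠
        (![z₀ w 0 * Circle.exp (![(1 : ℝ), 0, -1] 0 * (c w * ψ)), z₀ w 2 * Circle.exp (![(1 : ℝ), 0, -1] 2 * (c w * ψ))]) 1 := by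
    intro w h
    have h02 : (0 : Fin 3) = 2 := hinj w (by simpa only [Matrix.cons_val_zero, Matrix.cons_val_one, Matrix.head_cons] using h)
    exact absurd h02 (by decide)
  -- freeze the `U(Φ₁)`-coordinate `δ = γH(ψ).2`
  set δ := (γH ψ).2 with hδdef
  -- the point of ★ (3H) IS `γH ψ` (★ adapter)
  have hpt1 : (unitaryGroupOfFormCongrOfEq (UnitaryGroup.conjMixed (↥(maximalRealSubfield L)) L (IsCMField.complexConj L))
        (Matrix.GeneralLinearGroup.map (mixedEmbedding L) (Matrix.GeneralLinearGroup.mkOfDetNeZero !![(1 : L), 1; 1, -1] (UnitaryGroup.det_quasiSplitFrameTwo_ne_zero L)))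
        (UnitaryGroup.archFormOf L 2 (Matrix.diagonal ![(2 : L)⁻¹, -(2 : L)⁻¹])) (UnitaryGroup.archFormOf L 2 (Matrix.of fun i j : Fin 2 => if i.val + j.val + 1 = 2 then (1 : L) else 0))
        (UnitaryGroup.formCongr_map_mixedEmbedding_archFormOf_eq L (UnitaryGroup.formCongr_quasiSplitFrameTwo_diagonal L))).symm
        (UnitaryGroup.archDiagTorus L 2 ![(2 : L)⁻¹, -(2 : L)⁻¹]
          fun w => ![z₀ w 0 * Circle.exp (![(1 : ℝ), 0, -1] 0 * (c w * ψ)), z₀ w 2 * Circle.exp (![(1 : ℝ), 0, -1] 2 * (c w * ψ))]) = (γH ψ).1 := by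
    rw [archCongrOfEq_quasiSplitFrameTwo_symm_archDiagTorus, hγH]
  have hpt : ((unitaryGroupOfFormCongrOfEq (UnitaryGroup.conjMixed (↥(maximalRealSubfield L)) L (IsCMField.complexConj L))
        (Matrix.GeneralLinearGroup.map (mixedEmbedding L) (Matrix.GeneralLinearGroup.mkOfDetNeZero !![(1 : L), 1; 1, -1] (UnitaryGroup.det_quasiSplitFrameTwo_ne_zero L)))
        (UnitaryGroup.archFormOf L 2 (Matrix.diagonal ![(2 : L)⁻¹, -(2 : L)⁻¹])) (UnitaryGroup.archFormOf L 2 (Matrix.of fun i j : Fin 2 => if i.val + j.val + 1 = 2 then (1 : L) else 0))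
        (UnitaryGroup.formCongr_map_mixedEmbedding_archFormOf_eq L (UnitaryGroup.formCongr_quasiSplitFrameTwo_diagonal L))).symm
        (UnitaryGroup.archDiagTorus L 2 ![(2 : L)⁻¹, -(2 : L)⁻¹]
          fun w => ![z₀ w 0 * Circle.exp (![(1 : ℝ), 0, -1] 0 * (c w * ψ)), z₀ w 2 * Circle.exp (![(1 : ℝ), 0, -1] 2 * (c w * ψ))]), δ) = γH ψ :=
    Prod.ext hpt1 rfl
  -- ★ (E1)'s binders `hreg`, `hZ′` at the point: ★ (3R-G′), `hZ′` carried to `H′` by ★ (α) §3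
  have hreg : IsArchGRegular L (γH ψ) := isArchGRegular_archSingularCurve L α z₀ c γH γG hγH hγG ψ hinj
  rw [← hpt] at hreg
  have hZ' : ∀ γ', IsArchNormPair L H' (γH ψ) γ' → CompactSpace (Subgroup.centralizer ({γ'} : Set (UnitaryGroup.arch (↥(maximalRealSubfield L)) L (IsCMField.complexConj L) 3 H'))) :=
    compactSpace_centralizer_of_isArchNormPair_of_archCongr L T₃ Φ hΦ (γH ψ)
      (fun g hg => compactSpace_centralizer_of_isArchNormPair_archSingularCurve L α z₀ c γH γG hγH hγG hα hherm ψ hinj g hg)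
  rw [← hpt] at hZ'
  -- ★ (β₀) at `(u(ψ), δ)`, ★ (α) §2 on its right side
  have h := hβ₀ aH a' haH ha' hδ _ hu δ hreg hZ'
  rw [finsum_delta_mul_integral_comp_conj_eq_comap L T₃ Φ hΦ T ν' a' _] at h
  rw [← hpt]
  exact h

end Torus

end Literature.NumberTheory.Rogawski1990

end
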